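import Summits.QuantumFields.BalabanUV.T4Continuum.Support.NE3ProductPathChart
import Summits.QuantumFields.BalabanUV.T4Continuum.Support.NE3ProductPathPlaquettes
import HarnessLib

/-!
# T⁴ programme, node NE3 — route Π, file 5 of D-ne3p1-g25-1 §4: `DecomposedRep` ⟹ EXACTLY THE ∃-PACKAGE OF `hchart` OF THE END
# (`NE3EnergyRateWSupCurved.ne3EnergyRateWSup_sfClass_of_classSlicePoincare`): the endpoint chart, a GLOBAL sup of the path, and the two level
# lines (J1)(J2) — with the product path extended by `0` outside `(−1∕4, 5∕4)` so that the END's `∀ t` sup clause holds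

NE3 (node U1b), row NE3 OWNER `b2b-balaban-t4-ne3-p1` (gen 25).  Inputs BY NAME: `NE3ProductPathChart.endpointChart_of_decomposedRep` (p237527), `NE3EndpointChart.EndpointChart`,
`NE3ProductPathSizes.norm_pathΓ_le`, leaf-04-g7's `NE3ProductPathPlaquettes.pathΓ_rescale` ∕ `isSkewDir_real_smul`, `NE3ProductPath` (`pathΓ_one`, `isSkewDir_pathΓ`,
`isPeriodicDir_pathΓ`).

WHY.  The END quantifies its per-pair chart data as `∃ u Γ Ψ Ψ′ Xref α a, 0 ≤ α ∧ 0 ≤ a ∧ EndpointChart … θ κ θ₀ q a ∧ (∀ t x μ, ‖Γ t x μ‖ ≤ α) ∧ (J1) ∧ (J2)` with the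
sup clause over ALL `t : ℝ` (it is consumed on `[0,1]` only).  The product path `pathΓ X N t = skewHalf (log (e^{(1−t)²N}e^{(t−1)X}))` is controlled on `[0,1]`
(`norm_pathΓ_le`) and, by rescaling (`pathΓ_rescale`), on `(−1∕4, 5∕4)` when `(5∕4)α ≤ 1∕32`, `(25∕16)αN ≤ 1∕64`; outside we replace it by `0`.  Every field
of `EndpointChart` reads `Γ` either at `t ∈ [0,1]` or through `HasDerivAt` at `t ∈ [0,1]`, which only sees a neighbourhood — so the chart survives
(`endpointChart_congr_path`).

CONTENT (0 sorry): §1 `extPath` (DATA def) and its values∕skewness∕periodicity∕GLOBAL sup `‖extPath X N t‖ ≤ 10(α+αN)`; §2 `endpointChart_congr_path`;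
§3 **`hchartPackage_of_decomposedRep`**: `DecomposedRep 𝒞 L N k V U_A U_B u X N α αN ν κ₁ κ₂ a` with `α ≤ 1∕40`, `αN ≤ 1∕100` and the level lines
(J1) `(1 + 24√d(e^{10(α+αN)} − 1)L^k)² + 48·d·a·(L^k)² ≤ Λ`, (J2) `112·d·a·CP·(L^k)² ≤ 1∕(2·card n)` ⟹ the ∃-package with `θ = 2(1+4√(16d+1))ν`,
`κ = 2κ₁ + 912dκ₂`, `θ₀ = ν + 23√2√(16d+1)(1+ν)`, `q = 0`, path sup `10(α+αN)`, radius `a`.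

HONEST FRAMING.  Bookkeeping; `DecomposedRep` and the level lines are HYPOTHESES (route Π's junction `NE3DecomposedRepOfShapes` and the K-road supply them);
(P♮)_W's numeric lines, (H∃), T-E_w♯ and NE3 are NOT proved; spine PROVED 0∕9; finite T⁴ rung (B)+1 — NOT infinite volume, NOT mass gap, NOT `BetaPertH`,
NOT Clay.  PLACEMENT: `Summits/QuantumFields/BalabanUV/`.  HONEST DEPENDENCY: continuum YM on T⁴ ⇐ BetaPertH ∧ nine spine estimates (0/9 proved); BetaPertH ⇐
(D1) ∧ (D4) ∧ CAP+tail; G-an2-4 gates asym, D1 and NE2/3/4.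
-/

set_option autoImplicit false

open scoped BigOperators Matrix.Norms.L2Operator Topology
open NormedSpace Finset Filter

namespace Summit.QuantumFields.BalabanUV.T4Continuum.NE3EndpointPackageOfDecomposedRep

open Set
open Literature.MathematicalPhysics.QuantumFieldTheory.Balaban1983to89
open B7Prop1Explicit B7Prop2Explicit MatrixLog
open T4AveragingDeficitWall (IsSkewDir IsUnitaryCfg vary curl fhol)
open T4AveragingDeficitWallBoundary (periodBox)
open AveragingDeficitPeriodicCounting (IsPeriodicDir)
open AveragingDeficitChartCalculus (cavg)
open MinimalActionLevels (perWin)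
open NE3HessForm (dAction)
open NE3EnergyWeightedShapes (energyNormW)
open NE3FrameFreeSliceW (frameFreeBlockLandauW)
open NE3EndpointChart (EndpointChart)
open NE3ProductPath (pathΓ vel acc pathΓ_one isSkewDir_pathΓ isPeriodicDir_pathΓ)
open NE3ProductPathSizes (norm_pathΓ_le)
open NE3ProductPathChart (DecomposedRep endpointChart_of_decomposedRep)
open NE3ProductPathPlaquettes (pathΓ_rescale isSkewDir_real_smul)

noncomputable section

variable {d : ℕ} {n : Type*} [Fintype n] [DecidableEq n]

/-! ## §1 The product path extended by zero outside `(−1∕4, 5∕4)` -/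

/-- THE EXTENDED PRODUCT PATH: `pathΓ X N t` for `t ∈ (−1∕4, 5∕4)`, `0` outside. [folklore] -/
def extPath (X N : Site d → Fin d → Matrix n n ℂ) (t : ℝ) : Site d → Fin d → Matrix n n ℂ :=
  if t ∈ Ioo (-(1/4 : ℝ)) (5/4) then pathΓ X N t else fun _ _ => 0

/-- On the window the extended path is the product path. [folklore] -/
theorem extPath_of_mem {X N : Site d → Fin d → Matrix n n ℂ} {t : ℝ} (ht : t ∈ Ioo (-(1/4 : ℝ)) (5/4)) : extPath X N t = pathΓ X N t := by
  unfold extPath; rw [if_pos ht]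

/-- Off the window the extended path vanishes. [folklore] -/
theorem extPath_of_not_mem {X N : Site d → Fin d → Matrix n n ℂ} {t : ℝ} (ht : t ∉ Ioo (-(1/4 : ℝ)) (5/4)) : extPath X N t = fun _ _ => 0 := by
  unfold extPath; rw [if_neg ht]

/-- `[0,1] ⊂ (−1∕4, 5∕4)`. [folklore] -/
theorem mem_window_of_mem_Icc {t : ℝ} (ht : t ∈ Icc (0:ℝ) 1) : t ∈ Ioo (-(1/4 : ℝ)) (5/4) :=
  ⟨by linarith [ht.1], by linarith [ht.2]⟩

/-- Near a point of `[0,1]` the extended path IS the product path (eventually in `𝓝 t`). [folklore] -/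
theorem extPath_eventuallyEq {X N : Site d → Fin d → Matrix n n ℂ} {t : ℝ} (ht : t ∈ Icc (0:ℝ) 1) (y : Site d) (μ : Fin d) :
    (fun s => extPath X N s y μ) =ᶠ[𝓝 t] fun s => pathΓ X N s y μ := by
  filter_upwards [Ioo_mem_nhds (show -(1/4 : ℝ) < t by linarith [ht.1]) (show t < 5/4 by linarith [ht.2])] with s hs
  rw [extPath_of_mem hs]

/-- The extended path is skew at every time. [folklore] -/
theorem isSkewDir_extPath (X N : Site d → Fin d → Matrix n n ℂ) (t : ℝ) : IsSkewDir (extPath X N t) := by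
  by_cases ht : t ∈ Ioo (-(1/4 : ℝ)) (5/4)
  · rw [extPath_of_mem ht]; exact isSkewDir_pathΓ X N t
  · rw [extPath_of_not_mem ht]; exact fun _ _ => (skewAdjoint (Matrix n n ℂ)).zero_mem

/-- The extended path is periodic at every time. [folklore] -/
theorem isPeriodicDir_extPath {X N : Site d → Fin d → Matrix n n ℂ} {P : ℤ} (hX : IsPeriodicDir X P) (hN : IsPeriodicDir N P) (t : ℝ) :
    IsPeriodicDir (extPath X N t) P := by
  by_cases ht : t ∈ Ioo (-(1/4 : ℝ)) (5/4)
  · rw [extPath_of_mem ht]; exact isPeriodicDir_pathΓ hX hN t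
  · rw [extPath_of_not_mem ht]; exact fun _ _ _ => rfl

/-- **THE GLOBAL SUP OF THE EXTENDED PATH**: for skew `X`, `N` with `‖X‖ ≤ α ≤ 1∕40`, `‖N‖ ≤ αN ≤ 1∕100`: `‖extPath X N t x μ‖ ≤ 10(α+αN)` for EVERY `t`
(on the window by rescaling to time `0` with data `(1−t)X`, `(1−t)²N`; zero outside). [folklore] -/
theorem norm_extPath_le {X N : Site d → Fin d → Matrix n n ℂ} (hXs : IsSkewDir X) (hNs : IsSkewDir N) {α αN : ℝ}
    (hXα : ∀ x μ, ‖X x μ‖ ≤ α) (hNα : ∀ x μ, ‖N x μ‖ ≤ αN) (hα : α ≤ 1 / 40) (hαN : αN ≤ 1 / 100) (t : ℝ) (x : Site d) (μ : Fin d) :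
    ‖extPath X N t x μ‖ ≤ 10 * (α + αN) := by
  have hα0 : 0 ≤ α := (norm_nonneg _).trans (hXα x μ)
  have hαN0 : 0 ≤ αN := (norm_nonneg _).trans (hNα x μ)
  by_cases ht : t ∈ Ioo (-(1/4 : ℝ)) (5/4)
  · rw [extPath_of_mem ht, pathΓ_rescale X N t]
    have h1t : |1 - t| ≤ 5 / 4 := by rw [abs_le]; constructor <;> linarith [ht.1, ht.2]
    have h1t2 : (1 - t) ^ 2 ≤ 25 / 16 := by nlinarith [abs_nonneg (1 - t), sq_abs (1 - t)]
    have hX' : ∀ x μ, ‖(((1 - t : ℝ)) : ℂ) • X x μ‖ ≤ 5 / 4 * α := by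
      intro x μ
      rw [norm_smul, Complex.norm_real, Real.norm_eq_abs]
      exact mul_le_mul h1t (hXα x μ) (norm_nonneg _) (by norm_num)
    have hN' : ∀ x μ, ‖((((1 - t) ^ 2 : ℝ)) : ℂ) • N x μ‖ ≤ 25 / 16 * αN := by
      intro x μ
      rw [norm_smul, Complex.norm_real, Real.norm_eq_abs, abs_of_nonneg (sq_nonneg _)]
      exact mul_le_mul h1t2 (hNα x μ) (norm_nonneg _) (by norm_num)
    have h := norm_pathΓ_le (isSkewDir_real_smul hXs (1 - t)) (isSkewDir_real_smul hNs ((1 - t) ^ 2)) hX' hN' (by linarith) (by linarith)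
      (t := 0) ⟨le_rfl, zero_le_one⟩ x μ
    linarith
  · rw [extPath_of_not_mem ht, norm_zero]; positivity

/-! ## §2 The endpoint chart survives replacing the path by one that agrees with it on the window -/

/-- **AN ENDPOINT CHART ONLY SEES ITS PATH NEAR `[0,1]`**: if `Γ′ = Γ` on `(−1∕4, 5∕4)` and `Γ′ t` is skew and `(N·L^k)`-periodic for every `t`, the chart
with path `Γ` is a chart with path `Γ′` (same velocities, letters, radius). [folklore] -/
theorem endpointChart_congr_path {𝒞 : ℕ → Set (Site d → Fin d → (Matrix n n ℂ)ˣ)} {L N k : ℕ}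
    {V UA UB : Site d → Fin d → (Matrix n n ℂ)ˣ} {u : Site d → (Matrix n n ℂ)ˣ} {Γ Γ' Ψ Ψ' : ℝ → Site d → Fin d → Matrix n n ℂ}
    {Xref : Site d → Fin d → Matrix n n ℂ} {T : Set (Site d → Fin d → Matrix n n ℂ)} {Nrm : (Site d → Fin d → Matrix n n ℂ) → ℝ}
    {θ κ θ₀ q a : ℝ} (h : EndpointChart 𝒞 L N k V UA UB u Γ Ψ Ψ' Xref T Nrm θ κ θ₀ q a)
    (heq : ∀ t ∈ Ioo (-(1/4 : ℝ)) (5/4), Γ' t = Γ t) (hskew : ∀ t, IsSkewDir (Γ' t)) (hper : ∀ t, IsPeriodicDir (Γ' t) ((N * L ^ k : ℕ) : ℤ)) :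
    EndpointChart 𝒞 L N k V UA UB u Γ' Ψ Ψ' Xref T Nrm θ κ θ₀ q a := by
  have h0 : Γ' 0 = Γ 0 := heq 0 ⟨by norm_num, by norm_num⟩
  have h1 : Γ' 1 = Γ 1 := heq 1 ⟨by norm_num, by norm_num⟩
  have hI : ∀ t ∈ Icc (0:ℝ) 1, Γ' t = Γ t := fun t ht => heq t (mem_window_of_mem_Icc ht)
  exact
    { gauge := h.gauge
      rep := by rw [h0]; exact h.rep
      endW := by rw [h1]; exact h.endW
      skew := hskew
      per := hper
      vel := by
        intro t ht y μ
        have hv := h.vel t ht y μ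
        have hev : (fun s => exp (Γ' s y μ)) =ᶠ[𝓝 t] fun s => exp (Γ s y μ) := by
          filter_upwards [Ioo_mem_nhds (show -(1/4 : ℝ) < t by linarith [ht.1]) (show t < 5/4 by linarith [ht.2])] with s hs
          rw [heq s hs]
        rw [hI t ht]
        exact hv.congr_of_eventuallyEq hev
      acc := h.acc
      skewAcc := h.skewAcc
      admW := h.admW
      refT := h.refT
      perT := h.perT
      velocity := h.velocity
      close := by rw [h0]; exact h.close
      resDev := h.resDev
      small := by intro t ht p hp; rw [hI t ht]; exact h.small t ht p hp
      accel := by intro t ht; rw [hI t ht]; exact h.accel t ht }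

/-! ## §3 The ∃-package of the END's `hchart` from a decomposed representative -/

/-- **THE ∃-PACKAGE OF `hchart` FROM `DecomposedRep`** (`L, N ≥ 1`, `W = cavg L U_B` unitary; `α ≤ 1∕40`, `αN ≤ 1∕100`; level lines (J1)(J2) with the
path sup `10(α+αN)`).  The conclusion is LITERALLY the body of `hchart` of `NE3EnergyRateWSupCurved.ne3EnergyRateWSup_sfClass_of_classSlicePoincare` at
one pair, with `θ = 2(1+4√(16d+1))ν`, `κ = 2κ₁ + 912dκ₂`, `θ₀ = ν + 23√2√(16d+1)(1+ν)`, `q = 0`. [folklore] -/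
theorem hchartPackage_of_decomposedRep [Nonempty n] {𝒞 : ℕ → Set (Site d → Fin d → (Matrix n n ℂ)ˣ)} {L N k : ℕ} (hL : 1 ≤ L) (hN : 1 ≤ N)
    {V UA UB : Site d → Fin d → (Matrix n n ℂ)ˣ} (hW : IsUnitaryCfg (cavg L UB)) {u : Site d → (Matrix n n ℂ)ˣ}
    {X Nn : Site d → Fin d → Matrix n n ℂ} {α αN ν κ₁ κ₂ a CP Λ : ℝ} (h : DecomposedRep 𝒞 L N k V UA UB u X Nn α αN ν κ₁ κ₂ a)
    (hα : α ≤ 1 / 40) (hαN : αN ≤ 1 / 100)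
    (hJ1 : (1 + 24 * Real.sqrt d * (Real.exp (10 * (α + αN)) - 1) * (L : ℝ) ^ k) ^ 2 + 48 * d * a * ((L : ℝ) ^ k) ^ 2 ≤ Λ)
    (hJ2 : 112 * (d : ℝ) * a * CP * ((L : ℝ) ^ k) ^ 2 ≤ 1 / (2 * (Fintype.card n : ℝ))) :
    ∃ (u' : Site d → (Matrix n n ℂ)ˣ) (Γ Ψ Ψ' : ℝ → Site d → Fin d → Matrix n n ℂ) (Xref : Site d → Fin d → Matrix n n ℂ) (α' a' : ℝ),
      0 ≤ α' ∧ 0 ≤ a' ∧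
      EndpointChart 𝒞 L N k V UA UB u' Γ Ψ Ψ' Xref (frameFreeBlockLandauW L N k (cavg L UB))
        (fun Y => energyNormW L k (cavg L UB) Y (periodBox (N * L ^ k)))
        (2 * (1 + 4 * Real.sqrt (16 * d + 1)) * ν) (2 * κ₁ + 912 * d * κ₂) (ν + 23 * Real.sqrt 2 * Real.sqrt (16 * d + 1) * (1 + ν)) 0 a' ∧
      (∀ t (x : Site d) (μ : Fin d), ‖Γ t x μ‖ ≤ α') ∧
      (1 + 24 * Real.sqrt d * (Real.exp α' - 1) * (L : ℝ) ^ k) ^ 2 + 48 * d * a' * ((L : ℝ) ^ k) ^ 2 ≤ Λ ∧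
      112 * (d : ℝ) * a' * CP * ((L : ℝ) ^ k) ^ 2 ≤ 1 / (2 * (Fintype.card n : ℝ)) := by
  have hchart := endpointChart_of_decomposedRep hL hN hW h
  have hchart' := endpointChart_congr_path (Γ' := extPath X Nn) hchart (fun t ht => extPath_of_mem ht) (isSkewDir_extPath X Nn)
    (isPeriodicDir_extPath h.perX h.perN)
  refine ⟨u, extPath X Nn, _, _, X, 10 * (α + αN), a, by linarith [h.hα0, h.hαN0], h.ha, hchart', ?_, hJ1, hJ2⟩
  exact fun t x μ => norm_extPath_le h.skewX h.skewN h.supX h.supN hα hαN t x μ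

end

end Summit.QuantumFields.BalabanUV.T4Continuum.NE3EndpointPackageOfDecomposedRep
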